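import Summits.BirchSwinnertonDyer.BirchSwinnertonDyer.Theorems.CyclotomicUntwistPSRootNumberThreeTable
import Summits.BirchSwinnertonDyer.BirchSwinnertonDyer.Theorems.CyclotomicUntwistPSKodairaDictionary
import Literature.NumberTheory.EllipticCurves.RootNumberTableThreeCondExpProofs
import HarnessLib

/-!
# LAW L-w3 (kernel): the local root number at `3` on the cyclic wild rows of route `CyclotomicUntwist`
# — `W₃ = −1` exactly on the principal-series rows of Kodaira type `IV` / `IV*`

Cell `pub/bsd-wall` (D-0145 line `route-BirchSwinnertonDyer-CyclotomicUntwist`), seat `bsd-line-cycu-p4`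
(width seat 4, gen 4). Helper toward the cruxes K1 `PSRankOneLowerHalfAtThree`
(stmt-BirchSwinnertonDyer-21580) and K2 `PSRankOneUpperHalfAtThree` (stmt-21581), whose rows are the
PRINCIPAL-SERIES rows of the wild cell at `3` (`ClassO6 W 3`, `v₃(Δ_min)` even,
`Δ_min/3^{v₃Δ_min} ≡ 1 (mod 3)`). THEOREMS ONLY (no definition, no named fact, no `sorry`); BSD is not
proved by this file and no crux is. One more entry of the Tate-algorithm-at-`3` dictionary of these rows
(after `PSKodairaDictionary` f₃/Kodaira, LAW L-c3 `PSTamagawaThree`, LAW L-t3 `PSLocalThreeTorsion`,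
the `3`-adic tower `PSTowerOfEven`): the LOCAL ROOT NUMBER.

Notation: `W/ℚ` elliptic, globally minimal; `v := v₃(Δ_min)`; `Δ′ := Δ_min / 3^v`
(`minimalDiscUnitPartThree W`, `LocIrrThreeCriteria`); `W₃ := W.rootNumberThree`, the local root number at
`3` READ IN RIZZO'S TABLE II (`RootNumberTableThree`; its identification with an intrinsically defined
`w(E/ℚ₃)` is the tree's named fact `WeierstrassCurve.rootNumber_eq_neg_finprod_fullTableLocalRootNumberAt`,
untouched here — every statement below is about the table value, exactly as the O5 corollaries
`rootNumberThree_eq_one_of_kodairaSymbolAt_eq_III` etc. of `RootNumberTableThreeKodairaReductionProofs`).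

## What is proved

* §4 on the `f₃ = 4` rows, by `v` (`condExp W 3 = 4`; no other hypothesis):
  `rootNumberThree_eq_one_of_condExp_four_of_four` (`v = 4`, Kodaira `II`: `W₃ = +1`),
  `…_of_twelve` (`v = 12`, `II*`: `W₃ = +1`), `rootNumberThree_of_condExp_four_of_six` / `_of_ten`
  (`v = 6`, `IV` / `v = 10`, `IV*`: `W₃ = +1 ⟺ Δ′ ≡ 2 (mod 3)`), assembled as
  **`rootNumberThree_of_condExp_four`: `W₃ = if (v ≡ 2 (mod 4) ∧ Δ′ ≡ 1 (mod 3)) then −1 else +1`.**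
  Route: `f₃ = 4` is Table II's `v(N)` column (the DISCHARGED named fact
  `conductorExponent_eq_tableConductorExponentThree`, `…_holds`); with `v` it pins the row (table layer,
  `PSRootNumberThreeTable`); the row's condition on `c₄'` resp. `c₆'` is turned into `Δ′ mod 3` by the
  `c`-relation `1728·Δ_min = c₄³ − c₆²` of the integral minimal model (`64·Δ′ = c₄'³ − 3c₆'²` on `IV`,
  `192·Δ′ = c₄'³ − c₆'²` on `IV*`).
* §5 on the cells of the route: **`rootNumberThree_of_even`** (Addv ∧ SubW ∧ `v` even — the cyclic Kraus
  cell: same formula); on the PS rows of K1/K2 (`ClassO6 W 3`, `v` even, `Δ′ ≡ 1`):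
  **`rootNumberThree_of_psRow : W₃ = if v ≡ 2 (mod 4) then −1 else +1`**,
  `rootNumberThree_eq_neg_one_iff_of_psRow` (`⟺ v ≡ 2 (mod 4)`), `rootNumberThree_eq_one_iff_of_psRow`
  (`⟺ 4 ∣ v`), `…_iff_kodaira_of_psRow` (`⟺ K₃ ∈ {IV, IV*}`), `…_iff_krausInertiaOrderThree_of_psRow`
  (`⟺` Kraus's inertia order is `6`), `rootNumberThree_eq_neg_one_of_three_dvd_localTamagawaNumber_of_psRow`
  (`3 ∣ c₃ ⟹ W₃ = −1`); and on the supercuspidal-unramified rows (`Δ′ ≢ 1`):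
  **`rootNumberThree_eq_one_of_even_of_not_psRow : W₃ = +1`**; summary
  `rootNumberThree_eq_neg_one_iff_of_even : W₃ = −1 ⟺ v ≡ 2 (mod 4) ∧ Δ′ ≡ 1 (mod 3)`.

## Reading for the route (informal; nothing of this is asserted)

The route's local-type dictionary says `π₃(f_E) = PS(χ, χ⁻¹)` on the PS rows with `χ|_{ℤ₃^×}` of order
`#Φ ∈ {3, 6}` (Kraus), and supercuspidal (unramified induction) on the other cyclic rows. For a principal
series `ε₃ = ε(χ)ε(χ⁻¹) = χ(−1)`, which is `+1` for `χ` of order `3` and `(−1 | 3) = −1` for order `6`: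
exactly the law above (`W₃ = −1 ⟺ η` has order `6`, i.e. `W₃ = η(−1)` for the untwisting character `η`
mod `9`), while Table II gives `+1` on every supercuspidal cyclic row. So Rizzo's table — an independent,
census-validated source — AGREES with the PS/SCu assignment of the route (a consistency check adjacent to
kill criterion (ii)); the sign `η(−1)` of the route's analytic constant `κ = 9η(−1)/α²` (crux memo
GZ3-NUMERIC-TEST-v2, D4) is `W₃(E)`; and on the RANK-ONE PS rows (`w(E) = −1 = −∏_v w_v`) the product of
the local root numbers away from `3` equals `W₃`, i.e. `+1` on `II`/`II*` and `−1` on `IV`/`IV*`.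

References: O. G. Rizzo, Compositio Math. 136 (2003) 1–23, Table II [Rizzo2003]; E. Halberstadt, C. R.
Acad. Sci. Paris 326 (1998) [Halberstadt1998]; S. Kobayashi, Math. Ann. 323 (2002) 609–623 [Kobayashi2002];
A. Kraus, Manuscripta Math. 69 (1990) 353–385 [Kraus1990]; I. Papadopoulos, J. Number Theory 44 (1993)
[Papadopoulos1993]; J. H. Silverman, GTM 151 (1994), IV.9.4, IV.10–11 [SilvermanATAEC1994].
-/

open scoped Classical

open WeierstrassCurve IsDedekindDomain Rat.HeightOneSpectrum Literature.NumberTheory.EllipticCurves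
  Literature.NumberTheory.EllipticCurves.Rank1Residual Literature.NumberTheory.DiophantineGeometry
  Summit.BirchSwinnertonDyer.Rank1Residual.Additive
  Summit.BirchSwinnertonDyer.BirchSwinnertonDyer.Theorems.PSRootNumberThreeTable

-- single-conjunct summit: `Summit.BirchSwinnertonDyer.BirchSwinnertonDyer.…` repeats the name by design
set_option linter.dupNamespace false
set_option autoImplicit false

namespace Summit.BirchSwinnertonDyer.BirchSwinnertonDyer.Theorems.PSRootNumberThree

/-! ### §4 The local root number at `3` on the `f₃ = 4` rows, by `v₃(Δ_min)` -/

section Curves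

variable (W : WeierstrassCurve ℚ) [W.IsElliptic] [W.IsGloballyMinimal]

omit [W.IsGloballyMinimal] in
/-- `f₃ = 4` read on Table II (the discharged named fact
`WeierstrassCurve.conductorExponent_eq_tableConductorExponentThree`, `…_holds`).
[cite: Rizzo2003, Table II (p. 4), column v(N)] -/
theorem condExpOfInvariants_eq_four_of_condExp (hf : condExp W 3 = 4) :
    Rizzo.condExpOfInvariants W.c₄ W.c₆ W.Δ = 4 := by
  have h := WeierstrassCurve.conductorExponent_eq_tableConductorExponentThree_holds W (placeOf 3)
    (ringChar_int_quot_placeOf 3)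
  rw [tableConductorExponentThree_def] at h
  rw [← h]
  exact hf

omit [W.IsElliptic] in
/-- `c₄(W) = c₄(W_ℤ)` in `ℚ` for the integral minimal model `W_ℤ = integralModelInt W`. [folklore] -/
theorem c₄_eq_cast_integralModelInt : W.c₄ = (((integralModelInt W).c₄ : ℤ) : ℚ) := by
  have h := congrArg WeierstrassCurve.c₄ (map_integralModelInt W)
  rw [map_c₄] at h
  exact h.symm

omit [W.IsElliptic] in
/-- `c₆(W) = c₆(W_ℤ)` in `ℚ`. [folklore] -/
theorem c₆_eq_cast_integralModelInt : W.c₆ = (((integralModelInt W).c₆ : ℤ) : ℚ) := by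
  have h := congrArg WeierstrassCurve.c₆ (map_integralModelInt W)
  rw [map_c₆] at h
  exact h.symm

/-- `3 ∤ Δ′` for the unit part `Δ′ = Δ_min / 3^{v₃Δ_min}`. [folklore] -/
theorem not_three_dvd_minimalDiscUnitPartThree : ¬ (3 : ℤ) ∣ minimalDiscUnitPartThree W := by
  obtain ⟨u, hu, hu3⟩ := exists_eq_pow_mul_not_dvd (minimalDiscriminantInt_ne_zero W)
  have hD := minimalDiscriminantInt_eq_pow_mul_unitPart W
  have h3 : (3 : ℤ) ^ padicValInt 3 W.minimalDiscriminantInt ≠ 0 := pow_ne_zero _ (by norm_num)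
  have : minimalDiscUnitPartThree W = u := mul_left_cancel₀ h3 (hD.symm.trans hu)
  rw [this]
  exact hu3

/-- `Δ′ % 3 ∈ {1, 2}`: the principal-series rows (`Δ′ ≡ 1`) and the supercuspidal-unramified rows
(`Δ′ ≡ 2`) partition the cyclic cell. [folklore] -/
theorem emod_three_minimalDiscUnitPartThree :
    minimalDiscUnitPartThree W % 3 = 1 ∨ minimalDiscUnitPartThree W % 3 = 2 := by
  have hnd := not_three_dvd_minimalDiscUnitPartThree W
  have h0 : minimalDiscUnitPartThree W % 3 ≠ 0 := fun h ↦ hnd (Int.dvd_of_emod_eq_zero h)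
  have h1 := Int.emod_nonneg (minimalDiscUnitPartThree W) (show (3 : ℤ) ≠ 0 by norm_num)
  have h2 := Int.emod_lt_of_pos (minimalDiscUnitPartThree W) (show (0 : ℤ) < 3 by norm_num)
  omega

/-- **Row `II` (`f₃ = 4`, `v₃Δ_min = 4`): `W₃ = +1`.** [cite: Rizzo2003, Table II (p. 4), row (2,3,4)] -/
theorem rootNumberThree_eq_one_of_condExp_four_of_four (hf : condExp W 3 = 4)
    (hv : padicValInt 3 W.minimalDiscriminantInt = 4) : W.rootNumberThree = 1 := by
  have htab := condExpOfInvariants_eq_four_of_condExp W hf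
  have hvQ : padicValRat 3 W.Δ = 4 := by
    rw [padicValRat_Δ_eq_padicValInt_minimalDiscriminantInt W, hv]; rfl
  obtain ⟨hc4, hc6, hrows⟩ := rows_of_condExpOfInvariants_eq_four_of_mem htab (Or.inl hvQ)
  rcases hrows with ⟨h4, h6, -⟩ | ⟨-, -, h⟩ | ⟨-, -, h⟩ | ⟨-, -, h⟩
  · rw [rootNumberThree_def]
    exact w3OfInvariants_row_2_3_4 hc4 hc6 h4 h6 hvQ
  all_goals rw [hvQ] at h; exact absurd h (by norm_num)

/-- **Row `II*` (`f₃ = 4`, `v₃Δ_min = 12`): `W₃ = +1`.** [cite: Rizzo2003, Table II (p. 4), row (1,2,0)] -/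
theorem rootNumberThree_eq_one_of_condExp_four_of_twelve (hf : condExp W 3 = 4)
    (hv : padicValInt 3 W.minimalDiscriminantInt = 12) : W.rootNumberThree = 1 := by
  have htab := condExpOfInvariants_eq_four_of_condExp W hf
  have hvQ : padicValRat 3 W.Δ = 12 := by
    rw [padicValRat_Δ_eq_padicValInt_minimalDiscriminantInt W, hv]; rfl
  obtain ⟨hc4, hc6, hrows⟩ := rows_of_condExpOfInvariants_eq_four_of_mem htab
    (Or.inr (Or.inr (Or.inr hvQ)))
  rcases hrows with ⟨-, -, h⟩ | ⟨-, -, h⟩ | ⟨-, -, h⟩ | ⟨h4, h6, -⟩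
  pick_goal 4
  · rw [rootNumberThree_def]
    exact w3OfInvariants_row_5_8_12 hc4 hc6 h4 h6 hvQ
  all_goals rw [hvQ] at h; exact absurd h (by norm_num)

/-- **Row `IV` (`f₃ = 4`, `v₃Δ_min = 6`): `W₃ = +1` iff `Δ′ ≡ 2 (mod 3)`** — Table II's condition
`c₄' ≡ 2 (mod 3)` and the `c`-relation `64·Δ′ = c₄'³ − 3c₆'²` on the integral minimal model.
[cite: Rizzo2003, Table II (p. 4), row (3,5,6)] -/
theorem rootNumberThree_of_condExp_four_of_six (hf : condExp W 3 = 4)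
    (hv : padicValInt 3 W.minimalDiscriminantInt = 6) :
    W.rootNumberThree = if minimalDiscUnitPartThree W % 3 = 2 then 1 else -1 := by
  have htab := condExpOfInvariants_eq_four_of_condExp W hf
  have hvQ : padicValRat 3 W.Δ = 6 := by
    rw [padicValRat_Δ_eq_padicValInt_minimalDiscriminantInt W, hv]; rfl
  obtain ⟨hc4, hc6, hrows⟩ := rows_of_condExpOfInvariants_eq_four_of_mem htab (Or.inr (Or.inl hvQ))
  have h46 : padicValRat 3 W.c₄ = 3 ∧ padicValRat 3 W.c₆ = 5 := by
    rcases hrows with ⟨-, -, h⟩ | ⟨h4, h6, -⟩ | ⟨-, -, h⟩ | ⟨-, -, h⟩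
    pick_goal 2
    · exact ⟨h4, h6⟩
    all_goals rw [hvQ] at h; exact absurd h (by norm_num)
  rw [rootNumberThree_def, w3OfInvariants_row_3_5_6 hc4 hc6 h46.1 h46.2 hvQ]
  -- the integral minimal model and its unit parts
  have hc₄ := c₄_eq_cast_integralModelInt W
  have hc₆ := c₆_eq_cast_integralModelInt W
  have hC40 : (integralModelInt W).c₄ ≠ 0 := fun h ↦ hc4 (by rw [hc₄, h, Int.cast_zero])
  have hC60 : (integralModelInt W).c₆ ≠ 0 := fun h ↦ hc6 (by rw [hc₆, h, Int.cast_zero])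
  have hva : padicValInt 3 (integralModelInt W).c₄ = 3 := by
    have h := h46.1; rw [hc₄, padicValRat.of_int] at h; exact_mod_cast h
  have hvb : padicValInt 3 (integralModelInt W).c₆ = 5 := by
    have h := h46.2; rw [hc₆, padicValRat.of_int] at h; exact_mod_cast h
  obtain ⟨a, ha, ha3⟩ := exists_eq_pow_mul_not_dvd hC40
  obtain ⟨b, hb, hb3⟩ := exists_eq_pow_mul_not_dvd hC60
  rw [hva] at ha
  rw [hvb] at hb
  have hD := minimalDiscriminantInt_eq_pow_mul_unitPart W
  rw [hv] at hD
  have hrel : 1728 * W.minimalDiscriminantInt = (integralModelInt W).c₄ ^ 3 - (integralModelInt W).c₆ ^ 2 :=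
    (integralModelInt W).c_relation
  have hker : 64 * minimalDiscUnitPartThree W = a ^ 3 - 3 * b ^ 2 := by
    rw [ha, hb, hD] at hrel
    have h3 : (3 : ℤ) ^ 9 ≠ 0 := pow_ne_zero _ (by norm_num)
    apply mul_left_cancel₀ h3
    linear_combination hrel
  have hmod : a % 3 = minimalDiscUnitPartThree W % 3 := emod_three_eq_of_kernel_IV hker
  have hres : Rizzo.res9 W.c₄ = a % 9 := by
    rw [hc₄]
    exact res9_intCast_eq ha (by rw [← hc₄]; exact_mod_cast h46.1)
  rw [hres, Int.emod_emod_of_dvd a (by norm_num : (3 : ℤ) ∣ 9), hmod]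

/-- **Row `IV*` (`f₃ = 4`, `v₃Δ_min = 10`): `W₃ = +1` iff `Δ′ ≡ 2 (mod 3)`** — Table II's condition
`c₆' ≡ ±2 (mod 9)` and the `c`-relation `192·Δ′ = c₄'³ − c₆'²` on the integral minimal model.
[cite: Rizzo2003, Table II (p. 4), row (4,6,10)] -/
theorem rootNumberThree_of_condExp_four_of_ten (hf : condExp W 3 = 4)
    (hv : padicValInt 3 W.minimalDiscriminantInt = 10) :
    W.rootNumberThree = if minimalDiscUnitPartThree W % 3 = 2 then 1 else -1 := by
  have htab := condExpOfInvariants_eq_four_of_condExp W hf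
  have hvQ : padicValRat 3 W.Δ = 10 := by
    rw [padicValRat_Δ_eq_padicValInt_minimalDiscriminantInt W, hv]; rfl
  obtain ⟨hc4, hc6, hrows⟩ := rows_of_condExpOfInvariants_eq_four_of_mem htab
    (Or.inr (Or.inr (Or.inl hvQ)))
  have h46 : padicValRat 3 W.c₄ = 4 ∧ padicValRat 3 W.c₆ = 6 := by
    rcases hrows with ⟨-, -, h⟩ | ⟨-, -, h⟩ | ⟨h4, h6, -⟩ | ⟨-, -, h⟩
    pick_goal 3
    · exact ⟨h4, h6⟩
    all_goals rw [hvQ] at h; exact absurd h (by norm_num)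
  rw [rootNumberThree_def, w3OfInvariants_row_4_6_10 hc4 hc6 h46.1 h46.2 hvQ]
  have hc₄ := c₄_eq_cast_integralModelInt W
  have hc₆ := c₆_eq_cast_integralModelInt W
  have hC40 : (integralModelInt W).c₄ ≠ 0 := fun h ↦ hc4 (by rw [hc₄, h, Int.cast_zero])
  have hC60 : (integralModelInt W).c₆ ≠ 0 := fun h ↦ hc6 (by rw [hc₆, h, Int.cast_zero])
  have hva : padicValInt 3 (integralModelInt W).c₄ = 4 := by
    have h := h46.1; rw [hc₄, padicValRat.of_int] at h; exact_mod_cast h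
  have hvb : padicValInt 3 (integralModelInt W).c₆ = 6 := by
    have h := h46.2; rw [hc₆, padicValRat.of_int] at h; exact_mod_cast h
  obtain ⟨a, ha, ha3⟩ := exists_eq_pow_mul_not_dvd hC40
  obtain ⟨b, hb, hb3⟩ := exists_eq_pow_mul_not_dvd hC60
  rw [hva] at ha
  rw [hvb] at hb
  have hD := minimalDiscriminantInt_eq_pow_mul_unitPart W
  rw [hv] at hD
  have hrel : 1728 * W.minimalDiscriminantInt = (integralModelInt W).c₄ ^ 3 - (integralModelInt W).c₆ ^ 2 :=
    (integralModelInt W).c_relation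
  have hker : 192 * minimalDiscUnitPartThree W = a ^ 3 - b ^ 2 := by
    rw [ha, hb, hD] at hrel
    have h3 : (3 : ℤ) ^ 12 ≠ 0 := pow_ne_zero _ (by norm_num)
    apply mul_left_cancel₀ h3
    linear_combination hrel
  have hiff := emod_nine_iff_of_kernel_IVstar ha3 hb3 hker
  have hres : Rizzo.res9 W.c₆ = b % 9 := by
    rw [hc₆]
    exact res9_intCast_eq hb (by rw [← hc₆]; exact_mod_cast h46.2)
  rw [hres, Int.emod_emod_of_dvd b (dvd_refl (9 : ℤ))]
  simp only [hiff]

/-- **LAW L-w3 on the `f₃ = 4` rows.** For `W/ℚ` elliptic and globally minimal with `f₃ = 4` and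
`v = v₃(Δ_min) ∈ {4, 6, 10, 12}` (the cyclic wild cell): `W₃ = −1` iff `v ≡ 2 (mod 4)` (Kodaira
`IV`/`IV*`) and `Δ′ ≡ 1 (mod 3)` (principal series); `W₃ = +1` otherwise.
[cite: Rizzo2003, Table II (p. 4), rows (2,3,4), (3,5,6), (4,6,10), (1,2,0)] -/
theorem rootNumberThree_of_condExp_four (hf : condExp W 3 = 4)
    (hv : padicValInt 3 W.minimalDiscriminantInt = 4 ∨ padicValInt 3 W.minimalDiscriminantInt = 6 ∨
      padicValInt 3 W.minimalDiscriminantInt = 10 ∨ padicValInt 3 W.minimalDiscriminantInt = 12) :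
    W.rootNumberThree =
      if padicValInt 3 W.minimalDiscriminantInt % 4 = 2 ∧ minimalDiscUnitPartThree W % 3 = 1
      then -1 else 1 := by
  have h12 := emod_three_minimalDiscUnitPartThree W
  rcases hv with h | h | h | h
  · rw [rootNumberThree_eq_one_of_condExp_four_of_four W hf h, h, if_neg (by omega)]
  · rw [rootNumberThree_of_condExp_four_of_six W hf h, h]
    split_ifs <;> omega
  · rw [rootNumberThree_of_condExp_four_of_ten W hf h, h]
    split_ifs <;> omega
  · rw [rootNumberThree_eq_one_of_condExp_four_of_twelve W hf h, h, if_neg (by omega)]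

end Curves

/-! ### §5 The cyclic wild cell and the principal-series rows of K1/K2 -/

section Rows

variable (W : WeierstrassCurve ℚ) [W.IsElliptic] [W.IsGloballyMinimal]

/-- **LAW L-w3 on the cyclic wild cell at `3`.** For `W/ℚ` elliptic and globally minimal, additive at
`3` in the wild cell (w) (`SubW W 3`: `ord₃ j ≥ 0`, `f₃ ≠ 2`) with `v₃(Δ_min)` EVEN (cyclic inertia
`C₃`/`C₆`; Kodaira `II`/`IV`/`IV*`/`II*` with `v ∈ {4, 6, 10, 12}`, `f₃ = 4`), the local root number at `3`
read in Rizzo's Table II is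
`W₃ = −1 ⟺ v ≡ 2 (mod 4) ∧ Δ′ ≡ 1 (mod 3)` — the principal-series rows of Kodaira type `IV`/`IV*` —
and `W₃ = +1` on every other cyclic row. [cite: Rizzo2003, Table II (p. 4), rows (2,3,4), (3,5,6), (4,6,10), (1,2,0)]
[cite: Kraus1990, Théorème (p = 3)] -/
theorem rootNumberThree_of_even (hadd : Addv W 3) (hW : SubW W 3)
    (hev : Even (padicValInt 3 W.minimalDiscriminantInt)) :
    W.rootNumberThree =
      if padicValInt 3 W.minimalDiscriminantInt % 4 = 2 ∧ minimalDiscUnitPartThree W % 3 = 1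
      then -1 else 1 :=
  rootNumberThree_of_condExp_four W ((PSKodairaDictionary.condExp_eq_four_iff_even W hadd hW).mpr hev)
    (PSKodairaDictionary.padicValInt_mem_of_even W hadd hW hev)

omit [W.IsElliptic] in
/-- The unit part `Δ′` of `LocIrrThreeCriteria` is the quantity `Δ_min / 3^{v₃Δ_min}` of the route's
principal-series predicate (definitional). [folklore] -/
theorem minimalDiscUnitPartThree_eq :
    minimalDiscUnitPartThree W =
      W.minimalDiscriminantInt / 3 ^ padicValInt 3 W.minimalDiscriminantInt := rfl

/-- **The principal-series rows: `W₃ = −1 ⟺ v₃(Δ_min) ≡ 2 (mod 4)`.** On the rows of the cruxes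
`PSRankOneLowerHalfAtThree` / `PSRankOneUpperHalfAtThree` (`ClassO6 W 3`, `v₃(Δ_min)` even,
`Δ_min/3^v ≡ 1 (mod 3)`): `W₃ = −1` on the Kodaira `IV`/`IV*` rows (`v ∈ {6, 10}`, untwisting character
`η` of order `6`) and `W₃ = +1` on the `II`/`II*` rows (`v ∈ {4, 12}`, `η` of order `3`) — i.e.
`W₃ = η(−1) = χ(−1)` for `π₃(f_E) = PS(χ, χ⁻¹)`, the value the route's local-type dictionary predicts.
[cite: Rizzo2003, Table II (p. 4), rows (2,3,4), (3,5,6), (4,6,10), (1,2,0)] [cite: Kraus1990, Théorème (p = 3)] -/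
theorem rootNumberThree_of_psRow (hO6 : ClassO6 W 3) (hev : Even (padicValInt 3 W.minimalDiscriminantInt))
    (hps : W.minimalDiscriminantInt / 3 ^ padicValInt 3 W.minimalDiscriminantInt % 3 = 1) :
    W.rootNumberThree = if padicValInt 3 W.minimalDiscriminantInt % 4 = 2 then -1 else 1 := by
  have hps' : minimalDiscUnitPartThree W % 3 = 1 := hps
  rw [rootNumberThree_of_even W hO6.2.1 hO6.2.2 hev]
  by_cases h : padicValInt 3 W.minimalDiscriminantInt % 4 = 2
  · rw [if_pos ⟨h, hps'⟩, if_pos h]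
  · rw [if_neg (fun hc ↦ h hc.1), if_neg h]

/-- PS rows: **`W₃ = −1 ⟺ v₃(Δ_min) ≡ 2 (mod 4)`**. [cite: Rizzo2003, Table II (p. 4), rows (3,5,6), (4,6,10)] -/
theorem rootNumberThree_eq_neg_one_iff_of_psRow (hO6 : ClassO6 W 3)
    (hev : Even (padicValInt 3 W.minimalDiscriminantInt))
    (hps : W.minimalDiscriminantInt / 3 ^ padicValInt 3 W.minimalDiscriminantInt % 3 = 1) :
    W.rootNumberThree = -1 ↔ padicValInt 3 W.minimalDiscriminantInt % 4 = 2 := by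
  rw [rootNumberThree_of_psRow W hO6 hev hps]
  split_ifs with h
  · simp [h]
  · simp [h]

/-- PS rows: **`W₃ = +1 ⟺ 4 ∣ v₃(Δ_min)`** (Kodaira `II` / `II*`, `η` of order `3`).
[cite: Rizzo2003, Table II (p. 4), rows (2,3,4), (1,2,0)] -/
theorem rootNumberThree_eq_one_iff_of_psRow (hO6 : ClassO6 W 3)
    (hev : Even (padicValInt 3 W.minimalDiscriminantInt))
    (hps : W.minimalDiscriminantInt / 3 ^ padicValInt 3 W.minimalDiscriminantInt % 3 = 1) :
    W.rootNumberThree = 1 ↔ 4 ∣ padicValInt 3 W.minimalDiscriminantInt := by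
  rw [rootNumberThree_of_psRow W hO6 hev hps, Nat.dvd_iff_mod_eq_zero]
  have h2 : padicValInt 3 W.minimalDiscriminantInt % 2 = 0 := Nat.even_iff.mp hev
  split_ifs with h
  · exact ⟨fun hh ↦ absurd hh (by norm_num), fun hh ↦ by omega⟩
  · exact ⟨fun _ ↦ by omega, fun _ ↦ rfl⟩

/-- PS rows, Kodaira form: **`W₃ = −1 ⟺ K₃ ∈ {IV, IV*}`** (`K₃ = W.kodairaSymbolAt (placeOf 3)`).
[cite: Rizzo2003, Table II (p. 4)] [cite: Papadopoulos1993, Table (p = 3)] -/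
theorem rootNumberThree_eq_neg_one_iff_kodaira_of_psRow (hO6 : ClassO6 W 3)
    (hev : Even (padicValInt 3 W.minimalDiscriminantInt))
    (hps : W.minimalDiscriminantInt / 3 ^ padicValInt 3 W.minimalDiscriminantInt % 3 = 1) :
    W.rootNumberThree = -1 ↔
      (W.kodairaSymbolAt (placeOf 3) = .IV ∨ W.kodairaSymbolAt (placeOf 3) = .IVstar) := by
  rw [rootNumberThree_eq_neg_one_iff_of_psRow W hO6 hev hps]
  rcases PSKodairaDictionary.kodairaSymbolAt_of_even W hO6.2.1 hO6.2.2 hev with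
    ⟨hK, hv⟩ | ⟨hK, hv⟩ | ⟨hK, hv⟩ | ⟨hK, hv⟩ <;> rw [hK, hv] <;> decide

/-- PS rows, Kraus form: **`W₃ = −1 ⟺` Kraus's inertia order is `6`** (`W₃ = +1 ⟺` order `3`): the
local root number is `η(−1)` for the untwisting character `η` mod `9` of order `#Φ`.
[cite: Kraus1990, Théorème (p = 3)] [cite: Rizzo2003, Table II (p. 4)] -/
theorem rootNumberThree_eq_neg_one_iff_krausInertiaOrderThree_of_psRow (hO6 : ClassO6 W 3)
    (hev : Even (padicValInt 3 W.minimalDiscriminantInt))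
    (hps : W.minimalDiscriminantInt / 3 ^ padicValInt 3 W.minimalDiscriminantInt % 3 = 1) :
    W.rootNumberThree = -1 ↔ krausInertiaOrderThree W = 6 := by
  rw [rootNumberThree_eq_neg_one_iff_of_psRow W hO6 hev hps]
  obtain ⟨h3, h6⟩ := PSKodairaDictionary.krausInertiaOrderThree_of_even W hO6.2.1 hO6.2.2 hev
  have h2 : padicValInt 3 W.minimalDiscriminantInt % 2 = 0 := Nat.even_iff.mp hev
  constructor
  · exact h6
  · intro hk
    by_contra hne
    have h4 : 4 ∣ padicValInt 3 W.minimalDiscriminantInt := Nat.dvd_of_mod_eq_zero (by omega)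
    have := h3 h4
    omega

/-- PS rows: **`3 ∣ c₃ ⟹ W₃ = −1`** (`c₃ = 3` only occurs on Kodaira `IV`/`IV*`,
`PSKodairaDictionary.mod_four_eq_two_of_three_dvd_localTamagawaNumber`; the converse fails: the `IV`/`IV*`
rows with `c₆`-unit `≢ 1 (mod 3)` have `c₃ = 1` and `W₃ = −1`, LAW L-c3).
[cite: Rizzo2003, Table II (p. 4), rows (3,5,6), (4,6,10)] [cite: SilvermanATAEC1994, IV.9.4 Steps 5, 8] -/
theorem rootNumberThree_eq_neg_one_of_three_dvd_localTamagawaNumber_of_psRow (hO6 : ClassO6 W 3)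
    (hev : Even (padicValInt 3 W.minimalDiscriminantInt))
    (hps : W.minimalDiscriminantInt / 3 ^ padicValInt 3 W.minimalDiscriminantInt % 3 = 1)
    (h3 : 3 ∣ (W.baseChange ℚ_[3]).localTamagawaNumber ℤ_[3]) : W.rootNumberThree = -1 :=
  (rootNumberThree_eq_neg_one_iff_of_psRow W hO6 hev hps).mpr
    (PSKodairaDictionary.mod_four_eq_two_of_three_dvd_localTamagawaNumber W hO6.2.1 hO6.2.2 hev h3).1

/-- **The supercuspidal-unramified rows (`Δ′ ≢ 1 (mod 3)`, i.e. `Δ_min` not a `3`-adic square) of the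
cyclic cell: `W₃ = +1` always**, whatever the Kodaira type. [cite: Rizzo2003, Table II (p. 4), rows (2,3,4), (3,5,6), (4,6,10), (1,2,0)] -/
theorem rootNumberThree_eq_one_of_even_of_not_psRow (hadd : Addv W 3) (hW : SubW W 3)
    (hev : Even (padicValInt 3 W.minimalDiscriminantInt))
    (hns : W.minimalDiscriminantInt / 3 ^ padicValInt 3 W.minimalDiscriminantInt % 3 ≠ 1) :
    W.rootNumberThree = 1 := by
  rw [rootNumberThree_of_even W hadd hW hev, if_neg]
  rw [minimalDiscUnitPartThree_eq]
  exact fun h ↦ hns h.2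

/-- **On the cyclic cell `W₃ = −1` characterises the principal-series `IV`/`IV*` rows** (the rows where
`c₃ = 3` can occur and where the untwisting character has order `6`).
[cite: Rizzo2003, Table II (p. 4), rows (2,3,4), (3,5,6), (4,6,10), (1,2,0)] -/
theorem rootNumberThree_eq_neg_one_iff_of_even (hadd : Addv W 3) (hW : SubW W 3)
    (hev : Even (padicValInt 3 W.minimalDiscriminantInt)) :
    W.rootNumberThree = -1 ↔
      padicValInt 3 W.minimalDiscriminantInt % 4 = 2 ∧
        W.minimalDiscriminantInt / 3 ^ padicValInt 3 W.minimalDiscriminantInt % 3 = 1 := by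
  rw [rootNumberThree_of_even W hadd hW hev, ← minimalDiscUnitPartThree_eq]
  split_ifs with h
  · simp [h]
  · simp [h]

end Rows

end Summit.BirchSwinnertonDyer.BirchSwinnertonDyer.Theorems.PSRootNumberThree
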